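import Literature.NumberTheory.NumberFields.CubicFieldExplicit
import Mathlib.RingTheory.Polynomial.Eisenstein.IsIntegral
import HarnessLib

/-!
# Explicit cubic number fields: orders `ℤ[θ]` of finite index (conductor multiples, Eisenstein)

Continuation of `CubicFieldExplicit.lean` for a cubic number field `K = ℚ(θ)`, `θ` a root of the
monic irreducible `f = X³ + aX² + bX + c ∈ ℤ[X]`, WITHOUT the assumption `𝓞 K = ℤ[θ]`: everything
is relative to a natural number `N` with `N · 𝓞 K ⊆ ℤ[θ]` (a multiple of the conductor). PROVED:

* `exists_coords_of_mem_adjoin`: elements of `ℤ[θ]` are `u + vθ + wθ²`, `u, v, w ∈ ℤ`, and these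
  coordinates are unique (`coords_unique`);
* `disc_mul_mem_adjoin`: `Δ(f) · 𝓞 K ⊆ ℤ[θ]` (Mathlib `Algebra.discr_mul_isIntegral_mem_adjoin`);
* `mem_adjoin_of_eisenstein` (**Eisenstein at a totally ramified prime**): if `θ - s` is a root of
  a `p`-Eisenstein monic cubic, then `pⁿ x ∈ ℤ[θ] ⟹ x ∈ ℤ[θ]` for `x ∈ 𝓞 K` (Mathlib
  `mem_adjoin_of_smul_prime_pow_smul_of_minpoly_isEisensteinAt`), so the `p`-part of `Δ(f)` can
  be removed from `N`;
* `exists_ringHom_of_root_of_mul_mem` (**maps out of `𝓞 K` through `ℤ[θ]`**): if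
  `N · 𝓞 K ⊆ ℤ[θ]` and `S` is a commutative ring in which `N` is invertible, every root `τ` of `f`
  in `S` gives a ring homomorphism `ψ : 𝓞 K → S` with `ψ(θ) = τ` (`ψ(x) = N⁻¹ · (Nx)(τ)`); for
  `N = 1` this is the monogenic case of `CubicFieldIntegers.lean` without the square-factor
  hypothesis on `Δ(f)`. Used for residue and reduction maps of the cubic fields of conductor
  `103` (`ℤ[θ]` of index `3`) and `1339` (`Δ(f) = 1339²`) in
  `Literature/Barriers/BirchSwinnertonDyer/RankNotSumOfLocalInvariantsF3Cubic*.lean`.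

## References

* D. A. Marcus, *Number Fields*, 2nd ed. (2018), Ch. 2, Thm. 9 ff. (`d · 𝓞_K ⊆ ℤ[α]` for
  `d = disc(α)`), Ch. 3, Thm. 27 and Ex. 3.20 (orders of finite index).
  [cite: Marcus2018, Ch. 2, Thm. 9]
-/

noncomputable section

open Polynomial Module NumberField IntermediateField
open scoped NumberField

namespace Literature.NumberTheory.NumberFields

namespace MonicCubic

variable {K : Type*} [Field K] [NumberField K] {a b c : ℤ} {θ : K}

/-! ### Coordinates in `ℤ[θ]` -/

omit [NumberField K] in
/-- **Elements of `ℤ[θ]` are `u + vθ + wθ²`** (reduce a polynomial modulo the monic `f`).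
[folklore] -/
theorem exists_coords_of_mem_adjoin (hθ : aeval θ (poly a b c) = 0) {x : K}
    (hx : x ∈ Algebra.adjoin ℤ ({θ} : Set K)) :
    ∃ u v w : ℤ, x = u + v * θ + w * θ ^ 2 := by
  rw [Algebra.adjoin_singleton_eq_range_aeval] at hx
  obtain ⟨g, hg⟩ := hx
  have hmonic := monic_poly a b c
  set q := g %ₘ poly a b c with hq
  have hdeg : q.natDegree < 3 := by
    have := Polynomial.natDegree_modByMonic_lt g hmonic (by
      intro h
      have := congrArg Polynomial.natDegree h
      rw [natDegree_poly, Polynomial.natDegree_one] at this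
      exact absurd this (by norm_num))
    rwa [natDegree_poly] at this
  have hgq : aeval θ g = aeval θ q := by
    have h := Polynomial.modByMonic_add_div g (poly a b c)
    conv_lhs => rw [← h]
    rw [hq, map_add, map_mul, hθ, zero_mul, add_zero]
  refine ⟨q.coeff 0, q.coeff 1, q.coeff 2, ?_⟩
  rw [← hg]
  change aeval θ g = _
  rw [hgq, Polynomial.aeval_eq_sum_range' hdeg]
  simp [Finset.sum_range_succ, Algebra.smul_def]

/-- **Uniqueness of coordinates**: `1, θ, θ²` are linearly independent over `ℚ`. [folklore] -/
theorem coords_unique (hirr : Irreducible (polyQ a b c)) (hθ : aeval θ (poly a b c) = 0)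
    (h3 : finrank ℚ K = 3) {u v w u' v' w' : ℚ}
    (h : (u : K) + v * θ + w * θ ^ 2 = u' + v' * θ + w' * θ ^ 2) :
    u = u' ∧ v = v' ∧ w = w' := by
  have hli := (basis hirr hθ h3).linearIndependent
  have key := Fintype.linearIndependent_iff.mp hli ![u - u', v - v', w - w'] (by
    rw [Fin.sum_univ_three]
    simp only [basis_apply, Matrix.cons_val_zero, Matrix.cons_val_one, Matrix.cons_val_two,
      Matrix.head_cons, Matrix.tail_cons, Fin.val_zero, Fin.val_one, Fin.val_two, pow_zero,
      pow_one]
    rw [sub_smul, sub_smul, sub_smul]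
    simp only [Algebra.smul_def, eq_ratCast, mul_one]
    linear_combination h)
  have h0 := key 0; have h1 := key 1; have h2 := key 2
  simp only [Matrix.cons_val_zero, Matrix.cons_val_one, Matrix.cons_val_two, Matrix.head_cons,
    Matrix.tail_cons, sub_eq_zero] at h0 h1 h2
  exact ⟨h0, h1, h2⟩

/-- Integer coordinates are unique. [folklore] -/
theorem int_coords_unique (hirr : Irreducible (polyQ a b c)) (hθ : aeval θ (poly a b c) = 0)
    (h3 : finrank ℚ K = 3) {u v w u' v' w' : ℤ}
    (h : (u : K) + v * θ + w * θ ^ 2 = u' + v' * θ + w' * θ ^ 2) :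
    u = u' ∧ v = v' ∧ w = w' := by
  have := coords_unique hirr hθ h3 (u := u) (v := v) (w := w) (u' := u') (v' := v') (w' := w')
    (by push_cast; exact h)
  exact_mod_cast this

/-! ### `Δ(f) · 𝓞 K ⊆ ℤ[θ]` and the Eisenstein reduction -/

/-- **`Δ(f) · x ∈ ℤ[θ]` for every algebraic integer `x`** (`Δ(f) = disc(1, θ, θ²)`).
[cite: Marcus2018, Ch. 2, Thm. 9] -/
theorem disc_mul_mem_adjoin (hirr : Irreducible (polyQ a b c)) (hθ : aeval θ (poly a b c) = 0)
    (h3 : finrank ℚ K = 3) (x : 𝓞 K) :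
    ((disc a b c : ℤ) : K) * x ∈ Algebra.adjoin ℤ ({θ} : Set K) := by
  have key := Algebra.discr_mul_isIntegral_mem_adjoin (K := ℚ) (R := ℤ) (B := pb hirr hθ h3)
    (isIntegral_pb_gen hirr hθ h3) (z := (x : K)) (RingOfIntegers.isIntegral_coe x)
  rw [discr_pb hirr hθ h3, pb_gen] at key
  rw [show ((disc a b c : ℤ) : K) * x = (disc a b c : ℚ) • (x : K) by
    rw [Algebra.smul_def, eq_ratCast]; push_cast; rfl]
  exact key

omit [NumberField K] in
/-- `ℤ[θ - s] = ℤ[θ]` for `s ∈ ℤ`. [folklore] -/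
theorem adjoin_sub_intCast_eq (θ : K) (s : ℤ) :
    Algebra.adjoin ℤ ({θ - s} : Set K) = Algebra.adjoin ℤ ({θ} : Set K) := by
  apply le_antisymm
  · refine Algebra.adjoin_le (Set.singleton_subset_iff.mpr ?_)
    exact Subalgebra.sub_mem _ (Algebra.self_mem_adjoin_singleton ℤ θ)
      (intCast_mem _ s)
  · refine Algebra.adjoin_le (Set.singleton_subset_iff.mpr ?_)
    have hmem : (θ - s) + s ∈ Algebra.adjoin ℤ ({θ - s} : Set K) :=
      Subalgebra.add_mem _ (Algebra.self_mem_adjoin_singleton ℤ (θ - s)) (intCast_mem _ s)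
    rwa [sub_add_cancel] at hmem

/-- The coefficients of `poly a b c`: `c, b, a, 1`. [folklore] -/
theorem coeff_poly (a b c : ℤ) :
    (poly a b c).coeff 0 = c ∧ (poly a b c).coeff 1 = b ∧ (poly a b c).coeff 2 = a ∧
      (poly a b c).coeff 3 = 1 := by
  simp only [poly, coeff_add, coeff_C_mul, coeff_X_pow, coeff_X, coeff_C]
  norm_num

/-- **Eisenstein criterion for `X³ + aX² + bX + c` at `p`**: `p ∣ a, b, c` and `p² ∤ c`.
[folklore] -/
theorem isEisensteinAt_poly {a b c : ℤ} {p : ℕ} (hp : p.Prime) (ha : (p : ℤ) ∣ a)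
    (hb : (p : ℤ) ∣ b) (hc : (p : ℤ) ∣ c) (hc2 : ¬ (p : ℤ) ^ 2 ∣ c) :
    (poly a b c).IsEisensteinAt (Ideal.span {(p : ℤ)}) := by
  obtain ⟨h0, h1, h2, -⟩ := coeff_poly a b c
  have hp1 : ¬ (p : ℤ) ∣ 1 := fun h => hp.ne_one (by
    have := Int.eq_one_of_dvd_one (by positivity) h
    exact_mod_cast this)
  refine ⟨?_, fun {n} hn => ?_, ?_⟩
  · rw [(monic_poly a b c).leadingCoeff, Ideal.mem_span_singleton]; exact hp1
  · rw [natDegree_poly] at hn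
    rw [Ideal.mem_span_singleton]
    interval_cases n
    · rw [h0]; exact hc
    · rw [h1]; exact hb
    · rw [h2]; exact ha
  · rw [Ideal.span_singleton_pow, Ideal.mem_span_singleton, h0]; exact hc2

/-- **Removing the `p`-part of the conductor multiple at a totally ramified `p`** (Eisenstein):
if `θ - s` is a root of an irreducible monic cubic that is Eisenstein at `p`, then for every
algebraic integer `x`, `pⁿ x ∈ ℤ[θ]` implies `x ∈ ℤ[θ]` (Mathlib
`mem_adjoin_of_smul_prime_pow_smul_of_minpoly_isEisensteinAt`).
[cite: Marcus2018, Ch. 3, Thm. 27] -/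
theorem mem_adjoin_of_eisenstein (h3 : finrank ℚ K = 3) {a' b' c' s : ℤ}
    (hirr' : Irreducible (polyQ a' b' c')) (hθ' : aeval (θ - s) (poly a' b' c') = 0)
    {p : ℕ} (hp : p.Prime) (heis : (poly a' b' c').IsEisensteinAt (Ideal.span {(p : ℤ)}))
    {n : ℕ} {x : 𝓞 K} (hx : (p : K) ^ n * x ∈ Algebra.adjoin ℤ ({θ} : Set K)) :
    (x : K) ∈ Algebra.adjoin ℤ ({θ} : Set K) := by
  rw [← adjoin_sub_intCast_eq θ s] at hx ⊢
  have hgen : (pb hirr' hθ' h3).gen = θ - s := pb_gen hirr' hθ' h3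
  have hmin : minpoly ℤ (pb hirr' hθ' h3).gen = poly a' b' c' := by
    rw [hgen]; exact minpoly_int_eq hirr' hθ'
  have key := mem_adjoin_of_smul_prime_pow_smul_of_minpoly_isEisensteinAt (R := ℤ) (K := ℚ)
    (B := pb hirr' hθ' h3) (p := (p : ℤ)) (Nat.prime_iff_prime_int.mp hp)
    (isIntegral_pb_gen hirr' hθ' h3) (n := n) (z := (x : K)) (RingOfIntegers.isIntegral_coe x)
    (by rw [hgen, zsmul_eq_mul]; push_cast; exact hx) (by rw [hmin]; exact heis)
  rwa [hgen] at key

/-! ### Ring homomorphisms out of `𝓞 K` through `ℤ[θ] ⊇ N · 𝓞 K` -/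

section RingHom

variable {N : ℕ}

omit [NumberField K] in
/-- The integer coordinates of `N x` in `1, θ, θ²` (a choice, unique by `int_coords_unique`).
[folklore] -/
theorem exists_coordsN (hθ : aeval θ (poly a b c) = 0)
    (hN : ∀ x : 𝓞 K, (N : K) * x ∈ Algebra.adjoin ℤ ({θ} : Set K)) (x : 𝓞 K) : ∃ u : ℤ × ℤ × ℤ,
    (N : K) * x = u.1 + u.2.1 * θ + u.2.2 * θ ^ 2 := by
  obtain ⟨u, v, w, h⟩ := exists_coords_of_mem_adjoin hθ (hN x)
  exact ⟨⟨u, v, w⟩, h⟩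

omit [NumberField K] in
/-- The coordinate map `x ↦ (u, v, w)` with `N x = u + vθ + wθ²`. [folklore] -/
def coordsN (hθ : aeval θ (poly a b c) = 0)
    (hN : ∀ x : 𝓞 K, (N : K) * x ∈ Algebra.adjoin ℤ ({θ} : Set K)) (x : 𝓞 K) :
    ℤ × ℤ × ℤ := (exists_coordsN hθ hN x).choose

omit [NumberField K] in
/-- The defining property of `coordsN`. [folklore] -/
theorem coordsN_spec (hθ : aeval θ (poly a b c) = 0)
    (hN : ∀ x : 𝓞 K, (N : K) * x ∈ Algebra.adjoin ℤ ({θ} : Set K)) (x : 𝓞 K) :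
    (N : K) * x = (coordsN hθ hN x).1 + (coordsN hθ hN x).2.1 * θ +
      (coordsN hθ hN x).2.2 * θ ^ 2 :=
  (exists_coordsN hθ hN x).choose_spec

/-- Evaluation of a coordinate triple at `τ ∈ S`: `(u, v, w) ↦ u + vτ + wτ²`. [folklore] -/
def evalCoords {S : Type*} [CommRing S] (τ : S) (u : ℤ × ℤ × ℤ) : S :=
  u.1 + u.2.1 * τ + u.2.2 * τ ^ 2

/-- The product of two coordinate triples modulo `f` (`θ³ = -aθ² - bθ - c`,
`θ⁴ = (a² - b)θ² + (ab - c)θ + ac`). [folklore] -/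
def mulCoords (a b c : ℤ) (u v : ℤ × ℤ × ℤ) : ℤ × ℤ × ℤ :=
  let p0 := u.1 * v.1
  let p1 := u.1 * v.2.1 + u.2.1 * v.1
  let p2 := u.1 * v.2.2 + u.2.1 * v.2.1 + u.2.2 * v.1
  let p3 := u.2.1 * v.2.2 + u.2.2 * v.2.1
  let p4 := u.2.2 * v.2.2
  (p0 - c * p3 + a * c * p4, p1 - b * p3 + (a * b - c) * p4, p2 - a * p3 + (a * a - b) * p4)

omit [NumberField K] in
/-- `evalCoords` is multiplicative modulo `f` at any root of `f`. [folklore] -/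
theorem evalCoords_mulCoords {S : Type*} [CommRing S] {τ : S}
    (hτ : τ ^ 3 + (a : S) * τ ^ 2 + (b : S) * τ + (c : S) = 0) (u v : ℤ × ℤ × ℤ) :
    evalCoords τ (mulCoords a b c u v) = evalCoords τ u * evalCoords τ v := by
  simp only [evalCoords, mulCoords]
  push_cast
  linear_combination (-(u.2.1 : S) * v.2.2 - u.2.2 * v.2.1 - (u.2.2 : S) * v.2.2 * (τ - a)) * hτ

omit [NumberField K] in
/-- `evalCoords` is additive. [folklore] -/
theorem evalCoords_add {S : Type*} [CommRing S] (τ : S) (u v : ℤ × ℤ × ℤ) :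
    evalCoords τ (u + v) = evalCoords τ u + evalCoords τ v := by
  simp only [evalCoords, Prod.fst_add, Prod.snd_add]; push_cast; ring

/-- **Coordinates are additive and multiplicative**: `coordsN (x + y) = coordsN x + coordsN y`
and `N · coordsN (x y) = coordsN x * coordsN y (mod f)`. [folklore] -/
theorem coordsN_add (hirr : Irreducible (polyQ a b c)) (hθ : aeval θ (poly a b c) = 0)
    (h3 : finrank ℚ K = 3) (hN : ∀ x : 𝓞 K, (N : K) * x ∈ Algebra.adjoin ℤ ({θ} : Set K))
    (x y : 𝓞 K) :
    coordsN hθ hN (x + y) = coordsN hθ hN x + coordsN hθ hN y := by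
  have hx := coordsN_spec hθ hN x
  have hy := coordsN_spec hθ hN y
  have hxy := coordsN_spec hθ hN (x + y)
  have key : ((coordsN hθ hN (x + y)).1 : K) + (coordsN hθ hN (x + y)).2.1 * θ +
      (coordsN hθ hN (x + y)).2.2 * θ ^ 2 =
      ((coordsN hθ hN x).1 + (coordsN hθ hN y).1 : ℤ) +
        ((coordsN hθ hN x).2.1 + (coordsN hθ hN y).2.1 : ℤ) * θ +
        ((coordsN hθ hN x).2.2 + (coordsN hθ hN y).2.2 : ℤ) * θ ^ 2 := by
    simp only [RingOfIntegers.coe_eq_algebraMap, map_add] at hx hy hxy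
    push_cast
    rw [← hxy, mul_add, hx, hy]; ring
  obtain ⟨e1, e2, e3⟩ := int_coords_unique hirr hθ h3 key
  ext <;> simp [e1, e2, e3]

/-- `N · coordsN (x y) ≡ coordsN x · coordsN y`, as an identity of evaluations at any root of `f`
in any ring. [folklore] -/
theorem evalCoords_coordsN_mul (hirr : Irreducible (polyQ a b c)) (hθ : aeval θ (poly a b c) = 0)
    (h3 : finrank ℚ K = 3) (hN : ∀ x : 𝓞 K, (N : K) * x ∈ Algebra.adjoin ℤ ({θ} : Set K))
    {S : Type*} [CommRing S] {τ : S}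
    (hτ : τ ^ 3 + (a : S) * τ ^ 2 + (b : S) * τ + (c : S) = 0) (x y : 𝓞 K) :
    (N : S) * evalCoords τ (coordsN hθ hN (x * y)) =
      evalCoords τ (coordsN hθ hN x) * evalCoords τ (coordsN hθ hN y) := by
  -- compare the coordinates of `N² x y` computed in two ways
  have hx := coordsN_spec hθ hN x
  have hy := coordsN_spec hθ hN y
  have hxy := coordsN_spec hθ hN (x * y)
  set m := mulCoords a b c (coordsN hθ hN x) (coordsN hθ hN y) with hm
  have hprod : ((N : K) * x) * ((N : K) * y) = evalCoords θ m := by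
    rw [hm, evalCoords_mulCoords (theta_rel hθ), hx, hy]; rfl
  have hN2 : ((N : K) * x) * ((N : K) * y) = (N : K) * ((N : K) * ↑(x * y)) := by
    push_cast; ring
  have key : (((N : ℤ) * (coordsN hθ hN (x * y)).1 : ℤ) : K) +
      (((N : ℤ) * (coordsN hθ hN (x * y)).2.1 : ℤ) : K) * θ +
      (((N : ℤ) * (coordsN hθ hN (x * y)).2.2 : ℤ) : K) * θ ^ 2 =
      (m.1 : K) + (m.2.1 : K) * θ + (m.2.2 : K) * θ ^ 2 := by
    have : evalCoords θ m = (m.1 : K) + (m.2.1 : K) * θ + (m.2.2 : K) * θ ^ 2 := rfl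
    rw [← this, ← hprod, hN2, hxy]; push_cast; ring
  obtain ⟨e1, e2, e3⟩ := int_coords_unique hirr hθ h3 key
  rw [← evalCoords_mulCoords hτ, ← hm]
  simp only [evalCoords]
  rw [← e1, ← e2, ← e3]; push_cast; ring

/-- `coordsN 1 = (N, 0, 0)`. [folklore] -/
theorem coordsN_one (hirr : Irreducible (polyQ a b c)) (hθ : aeval θ (poly a b c) = 0)
    (h3 : finrank ℚ K = 3) (hN : ∀ x : 𝓞 K, (N : K) * x ∈ Algebra.adjoin ℤ ({θ} : Set K)) :
    coordsN hθ hN 1 = ((N : ℤ), 0, 0) := by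
  have h := coordsN_spec hθ hN 1
  have key : ((coordsN hθ hN 1).1 : K) + (coordsN hθ hN 1).2.1 * θ +
      (coordsN hθ hN 1).2.2 * θ ^ 2 = ((N : ℤ) : K) + (0 : ℤ) * θ + (0 : ℤ) * θ ^ 2 := by
    rw [← h]; push_cast; simp
  obtain ⟨e1, e2, e3⟩ := int_coords_unique hirr hθ h3 key
  ext <;> simp [e1, e2, e3]

/-- `coordsN θ = (0, N, 0)`. [folklore] -/
theorem coordsN_thetaInt (hirr : Irreducible (polyQ a b c)) (hθ : aeval θ (poly a b c) = 0)
    (h3 : finrank ℚ K = 3) (hN : ∀ x : 𝓞 K, (N : K) * x ∈ Algebra.adjoin ℤ ({θ} : Set K)) :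
    coordsN hθ hN (thetaInt hθ) = (0, (N : ℤ), 0) := by
  have h := coordsN_spec hθ hN (thetaInt hθ)
  have key : ((coordsN hθ hN (thetaInt hθ)).1 : K) + (coordsN hθ hN (thetaInt hθ)).2.1 * θ +
      (coordsN hθ hN (thetaInt hθ)).2.2 * θ ^ 2 =
      ((0 : ℤ) : K) + ((N : ℤ) : K) * θ + (0 : ℤ) * θ ^ 2 := by
    rw [← h]; push_cast; simp [thetaInt]
  obtain ⟨e1, e2, e3⟩ := int_coords_unique hirr hθ h3 key
  ext <;> simp [e1, e2, e3]

/-- **Ring homomorphisms out of `𝓞 K` from roots of `f`**, through an order `ℤ[θ] ⊇ N · 𝓞 K`: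
if `N` is invertible in the commutative ring `S` and `τ ∈ S` is a root of `f`, then
`x ↦ N⁻¹ · (coordinates of N x)(τ)` is a ring homomorphism `𝓞 K → S` sending `θ ↦ τ` (for
`𝓞 K = ℤ[θ]` take `N = 1`). Used for residue maps `𝓞 K → ℤ/q`, reductions `𝓞 K → (ℤ/8)[t]/(f)`
and the like. [cite: Marcus2018, Ch. 3, Thm. 27] -/
theorem exists_ringHom_of_root_of_mul_mem (hirr : Irreducible (polyQ a b c))
    (hθ : aeval θ (poly a b c) = 0) (h3 : finrank ℚ K = 3)
    (hN : ∀ x : 𝓞 K, (N : K) * x ∈ Algebra.adjoin ℤ ({θ} : Set K)) {S : Type*} [CommRing S]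
    (τ : S)
    (hτ : τ ^ 3 + (a : S) * τ ^ 2 + (b : S) * τ + (c : S) = 0) (s' : S)
    (hs' : (N : S) * s' = 1) :
    ∃ ψ : 𝓞 K →+* S, ψ (thetaInt hθ) = τ := by
  let F : 𝓞 K → S := fun x => s' * evalCoords τ (coordsN hθ hN x)
  have hmul : ∀ x y, F (x * y) = F x * F y := fun x y => by
    show s' * evalCoords τ (coordsN hθ hN (x * y)) =
      s' * evalCoords τ (coordsN hθ hN x) * (s' * evalCoords τ (coordsN hθ hN y))
    have := evalCoords_coordsN_mul hirr hθ h3 hN hτ x y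
    linear_combination (-(s' * evalCoords τ (coordsN hθ hN (x * y)))) * hs' + s' ^ 2 * this
  have hone : F 1 = 1 := by
    show s' * evalCoords τ (coordsN hθ hN 1) = 1
    rw [coordsN_one hirr hθ h3 hN]; simp [evalCoords]; linear_combination hs'
  have hadd : ∀ x y, F (x + y) = F x + F y := fun x y => by
    show s' * evalCoords τ (coordsN hθ hN (x + y)) =
      s' * evalCoords τ (coordsN hθ hN x) + s' * evalCoords τ (coordsN hθ hN y)
    rw [coordsN_add hirr hθ h3 hN, evalCoords_add]; ring
  let φ : 𝓞 K →* S := { toFun := F, map_one' := hone, map_mul' := hmul }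
  refine ⟨RingHom.mk' φ hadd, ?_⟩
  show s' * evalCoords τ (coordsN hθ hN (thetaInt hθ)) = τ
  rw [coordsN_thetaInt hirr hθ h3 hN]; simp [evalCoords]; linear_combination τ * hs'

end RingHom

end MonicCubic

end Literature.NumberTheory.NumberFields

end
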